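import Summits.BirchSwinnertonDyer.BirchSwinnertonDyer.Theorems.PrintX6EisensteinHalfFiveLeRestResidual
import Summits.BirchSwinnertonDyer.BirchSwinnertonDyer.Theorems.PrintX6AnticyclotomicRankZeroInertPair
import HarnessLib

/-!
# Route `PrintX6` after road (I): given the nine published facts of the inert-pair road, the leaf's
# deficit is EXACTLY `RestThin ∧ EisensteinHalfAtThree` (route currency and leaf currency)

HONEST FRAMING (cell `bsd-print-x6`, run/shared/lean/pub/bsd-print-x6/; PRINT tier D-0131 (2);
prover p3 gen 2, road (I) = PLAN.md v4.2 (R2)). THEOREMS ONLY; bookkeeping over landed theorems;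
nothing about any particular curve is asserted; BSD is not proved by any of this; no cell of the
partition moves. Everything is CONDITIONAL on the route's input conjunctions BY NAME
(`PublishedInputsX6`, the pack `PublishedAcInputsX6Err` — tier HELD) and on the NINE published named
facts of road (I) (`hSh`, `hFH`, `hJL`, `hRT`, `h23`, `hK13`, `hGZK`, `hnf`, `hMaz`; CW24 flags HELD),
taken as hypotheses.

STATE. The residual crux `EisensteinHalfFiveLeRest` (stmt-BirchSwinnertonDyer-21116: E₅ at `p ≥ 5` off
the erratum sub-locus) is proved BY NAME on the sub-class "two multiplicative primes `ℓ₁ ≠ ℓ₂` with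
`p ∤ ord_{ℓ_i}(Δ_min)`" by `AnticyclotomicRankZero.eisensteinHalfFiveLeRest_inertPair_of_facts`
(`PrintX6AnticyclotomicRankZeroInertPair.lean`). This file records what is LEFT: the THIN part
"`RestThin`" = E₅ at pairs of the leaf with `p ≥ 5`, no erratum prime, and NO such pair of primes
(spelled inline below; of the 113 non-unit census cells at `p ≥ 5` NONE is thin — ty3's table
`X6R0-ERRATUM-v1.tsv`: every cell has two multiplicative primes with `p ∤ ord Δ`), and the `p = 3` crux.

* §1 (route currency) `(nine facts) → RestThin → EisensteinHalfFiveLeRest`;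
  `PublishedInputsX6 → PublishedAcInputsX6Err → (nine facts) → (WAllCornerX6r0 ↔ RestThin ∧ EisensteinHalfAtThree)`
  and the closing shape — the rung W-ALL/6 (leaf `ClassX6 ∧ r_an = 0`) holds IFF the thin residual and
  the `p = 3` crux hold (p2's `wallCornerX6r0_iff_rest_and_atThree_…` with Rest cut down by road (I)).
* §2 (leaf currency, Miller's `BSDp`) pair level on the inert-pair sub-class over `PublishedInputsX6` +
  the nine facts (upper half = the route's PROVED `UpperHalfX6`); class level: the rung ⟺ «`BSD(E,p)` at
  every THIN leaf pair with `p ≥ 5`» ∧ «`BSD(E,p)` at every leaf pair with `p = 3`».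

beyond-print theorem: NO (bookkeeping; the beyond-print content is road (I)'s). PARTITION: 0 cells.
[cite: Kobayashi2003, Thm. 1.2 (p. 2) and Thm. 4.1 (p. 8)] [cite: BDKim2013, Cor. 3.15 (p. 199)]
[cite: CastellaWan2023, Thm. 5.3] [cite: JetchevSkinnerWan2017, §5.1.2, §7.4] [cite: Miller2011LMS, §1 and Def. 1.1]
-/

set_option autoImplicit false
-- the landed namespace `Summit.BirchSwinnertonDyer.BirchSwinnertonDyer.Theorems` (summit = problem) trips the linter
set_option linter.dupNamespace false

open WeierstrassCurve Literature.NumberTheory.EllipticCurves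
  Literature.NumberTheory.EllipticCurves.ModularForms
  Literature.NumberTheory.EllipticCurves.Rank1Residual
  Literature.NumberTheory.EllipticCurves.Rank1Residual.Typed
  Literature.NumberTheory.EllipticCurves.Castella2018
  Literature.NumberTheory.Automorphic
  Summit.BirchSwinnertonDyer.BirchSwinnertonDyer.Theses.PrintX6
-- only these two names from ty2's namespace (its `PublishedAcInputsX6Err` would clash with the route's)
open Summit.BirchSwinnertonDyer.Rank1Residual.Supersingular (HasErratumPrime missingPPartAt_of_upper_of_nonUnit)

namespace Summit.BirchSwinnertonDyer.BirchSwinnertonDyer.Theorems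

section RoadI

variable
  -- the nine published named facts of road (I)
  (hSh : shimuraCurve_heegnerPoint_grossZagier_bdpLowerBound_goodSS)
  (hFH : friedbergHoffstein_exists_twist_simpleZero_inertAt_splitAt)
  (hJL : nonempty_shimuraParametrizationData) (hRT : PastenShimura2024_ribetTakahashiPackage)
  (h23 : thm23_anticyclotomicControl) (hK13 : Kobayashi2013.rem13_padicValRat_bsd_rank_one_le_of_kato)
  (hGZK : rank_eq_analyticRank_of_analyticRank_le_one) (hnf : exists_isNewformOf)
  (hMaz : mazur_not_dvd_maninConstant_of_odd)

include hSh hFH hJL hRT h23 hK13 hGZK hnf hMaz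

/-! ## §1 Route currency: the residual cut down to its thin part -/

/-- **Rest from its THIN part, given the nine facts of road (I)**: if E₅ holds at every pair of the leaf
with `p ≥ 5`, no erratum prime and NO two multiplicative primes `ℓ₁ ≠ ℓ₂` with `p ∤ ord_{ℓ_i}(Δ_min)`
("RestThin", spelled inline: any two distinct multiplicative primes have `p ∣ ord` at one of them),
then `EisensteinHalfFiveLeRest` — the other pairs are `eisensteinHalfFiveLeRest_inertPair_of_facts`
(classical case split). CONDITIONAL on the nine facts. [cite: CastellaWan2023, Thm. 5.3]
[cite: JetchevSkinnerWan2017, §5.1.2, §7.4] [cite: Miller2011LMS, Def. 1.1] -/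
theorem eisensteinHalfFiveLeRest_of_inertPairFacts_of_thin
    (hThin : ∀ (W : WeierstrassCurve ℚ) [W.IsElliptic] [W.IsGloballyMinimal] (p : ℕ) [Fact p.Prime],
      ¬ W.HasCM → 5 ≤ p → ClassX6 W p → W.analyticRank = 0 → ¬ HasErratumPrime W p →
      (∀ (ℓ₁ ℓ₂ : ℕ) [Fact ℓ₁.Prime] [Fact ℓ₂.Prime], ℓ₁ ≠ ℓ₂ → Mult W ℓ₁ → Mult W ℓ₂ →
        ¬ p ∣ padicValInt ℓ₁ W.minimalDiscriminantInt → p ∣ padicValInt ℓ₂ W.minimalDiscriminantInt) →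
      ∀ q : ℚ, shaAn W = (q : ℂ) → padicValRat p q ≠ 0 → padicValRat p q ≤ (padicValNat p W.shaOrder : ℤ)) :
    EisensteinHalfFiveLeRest := by
  intro W _ _ p _ hCM h5 hX h0 hE q hq hv
  by_cases hpair : ∀ (ℓ₁ ℓ₂ : ℕ) [Fact ℓ₁.Prime] [Fact ℓ₂.Prime], ℓ₁ ≠ ℓ₂ → Mult W ℓ₁ → Mult W ℓ₂ →
      ¬ p ∣ padicValInt ℓ₁ W.minimalDiscriminantInt → p ∣ padicValInt ℓ₂ W.minimalDiscriminantInt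
  · exact hThin W p hCM h5 hX h0 hE hpair q hq hv
  · push Not at hpair
    obtain ⟨ℓ₁, ℓ₂, i₁, i₂, hne, h₁, h₂, hr₁, hr₂⟩ := hpair
    exact AnticyclotomicRankZero.eisensteinHalfFiveLe_inertPair_of_facts hSh hFH hJL hRT h23 hK13 hGZK hnf
      hMaz W p hCM h5 hX h0 ℓ₁ ℓ₂ hne h₁ h₂ hr₁ hr₂ q hq hv

/-- **The hErr- AND hPair-discharged residual iff.** Over `PublishedInputsX6`, the pack
`PublishedAcInputsX6Err` and the nine facts of road (I):
`WAllCornerX6r0 ↔ (RestThin ∧ EisensteinHalfAtThree)` — the rung W-ALL/6 on the leaf `ClassX6 ∧ r_an = 0`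
holds IFF E₅ holds on the THIN pairs at `p ≥ 5` (no erratum prime, no inert-pair witness; 0 of 113
census cells) and E₃ holds. `→`: p2's iff gives Rest, which specialises to its thin part; `←`:
`eisensteinHalfFiveLeRest_of_inertPairFacts_of_thin` and p2's closing shape. CONDITIONAL on the inputs.
[cite: Kobayashi2003, Thm. 1.2 and Thm. 4.1] [cite: BDKim2013, Cor. 3.15] [cite: Miller2011LMS, Def. 1.1] -/
theorem wallCornerX6r0_iff_thin_and_atThree_of_inputs_of_inertPairFacts
    (hPub : PublishedInputsX6) (hAc : PublishedAcInputsX6Err) :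
    Summit.BirchSwinnertonDyer.WAllCornerX6r0 ↔
      ((∀ (W : WeierstrassCurve ℚ) [W.IsElliptic] [W.IsGloballyMinimal] (p : ℕ) [Fact p.Prime],
          ¬ W.HasCM → 5 ≤ p → ClassX6 W p → W.analyticRank = 0 → ¬ HasErratumPrime W p →
          (∀ (ℓ₁ ℓ₂ : ℕ) [Fact ℓ₁.Prime] [Fact ℓ₂.Prime], ℓ₁ ≠ ℓ₂ → Mult W ℓ₁ → Mult W ℓ₂ →
            ¬ p ∣ padicValInt ℓ₁ W.minimalDiscriminantInt →
              p ∣ padicValInt ℓ₂ W.minimalDiscriminantInt) →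
          ∀ q : ℚ, shaAn W = (q : ℂ) → padicValRat p q ≠ 0 →
            padicValRat p q ≤ (padicValNat p W.shaOrder : ℤ)) ∧
        EisensteinHalfAtThree) := by
  rw [wallCornerX6r0_iff_rest_and_atThree_of_publishedInputsX6_of_publishedAcInputsX6Err hPub hAc]
  refine ⟨fun ⟨hRest, h3⟩ ↦ ⟨fun W _ _ p _ hCM h5 hX h0 hE _ ↦ hRest W p hCM h5 hX h0 hE, h3⟩,
    fun ⟨hThin, h3⟩ ↦ ⟨?_, h3⟩⟩
  exact eisensteinHalfFiveLeRest_of_inertPairFacts_of_thin hSh hFH hJL hRT h23 hK13 hGZK hnf hMaz hThin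

/-- The closing shape after road (I):
`PublishedInputsX6 → PublishedAcInputsX6Err → (nine facts) → RestThin → EisensteinHalfAtThree → WAllCornerX6r0`.
[cite: Miller2011LMS, Def. 1.1] -/
theorem wallCornerX6r0_of_inputs_of_inertPairFacts_of_thin_of_atThree
    (hPub : PublishedInputsX6) (hAc : PublishedAcInputsX6Err)
    (hThin : ∀ (W : WeierstrassCurve ℚ) [W.IsElliptic] [W.IsGloballyMinimal] (p : ℕ) [Fact p.Prime],
      ¬ W.HasCM → 5 ≤ p → ClassX6 W p → W.analyticRank = 0 → ¬ HasErratumPrime W p →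
      (∀ (ℓ₁ ℓ₂ : ℕ) [Fact ℓ₁.Prime] [Fact ℓ₂.Prime], ℓ₁ ≠ ℓ₂ → Mult W ℓ₁ → Mult W ℓ₂ →
        ¬ p ∣ padicValInt ℓ₁ W.minimalDiscriminantInt → p ∣ padicValInt ℓ₂ W.minimalDiscriminantInt) →
      ∀ q : ℚ, shaAn W = (q : ℂ) → padicValRat p q ≠ 0 → padicValRat p q ≤ (padicValNat p W.shaOrder : ℤ))
    (h3 : EisensteinHalfAtThree) : Summit.BirchSwinnertonDyer.WAllCornerX6r0 :=
  (wallCornerX6r0_iff_thin_and_atThree_of_inputs_of_inertPairFacts hSh hFH hJL hRT h23 hK13 hGZK hnf hMaz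
    hPub hAc).mpr ⟨hThin, h3⟩

/-! ## §2 Leaf currency (`BSDp`): the inert-pair sub-leaf pair by pair; the residual as a set of pairs -/

section PairLevel

variable (W : WeierstrassCurve ℚ) [W.IsElliptic] [W.IsGloballyMinimal] (p : ℕ) [Fact p.Prime]

/-- **Pair level, inert-pair sub-locus: `BSD(E,p)` over `PublishedInputsX6` and the nine facts.** For a
pair of the leaf (`ClassX6 W p`, `r_an = 0`) with `p ≥ 5` and two multiplicative primes `ℓ₁ ≠ ℓ₂` with
`p ∤ ord_{ℓ_i}(Δ_min)`: upper half by the route's PROVED `UpperHalfX6` (`upperHalfX6_proof`), lower half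
on the non-unit value by road (I) (`AnticyclotomicRankZero.eisensteinHalfFiveLe_inertPair_of_facts`;
`¬ CM` by `ClassX6.not_hasCM`), value-cell split `missingPPartAt_of_upper_of_nonUnit`, then
`bsdp_of_missingPPartAt` with GZK. CONDITIONAL (HELD); per pair it is what ALL 113 non-unit census cells
at `p ≥ 5` inherit by this road (each has such a pair of primes). [cite: Kobayashi2003, Thm. 1.2 and Thm. 4.1]
[cite: BDKim2013, Cor. 3.15] [cite: CastellaWan2023, Thm. 5.3] [cite: Miller2011LMS, §1 and Def. 1.1] -/
theorem X6.bsdp_of_publishedInputsX6_of_inertPairFacts (hPub : PublishedInputsX6) (h5 : 5 ≤ p)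
    (hX : ClassX6 W p) (h0 : W.analyticRank = 0)
    (ℓ₁ ℓ₂ : ℕ) [Fact ℓ₁.Prime] [Fact ℓ₂.Prime] (hne : ℓ₁ ≠ ℓ₂) (h₁ : Mult W ℓ₁) (h₂ : Mult W ℓ₂)
    (hr₁ : ¬ p ∣ padicValInt ℓ₁ W.minimalDiscriminantInt)
    (hr₂ : ¬ p ∣ padicValInt ℓ₂ W.minimalDiscriminantInt) : BSDp W p :=
  bsdp_of_missingPPartAt W p hPub.2.2.2.2.2.2.2.2 (by omega)
    (missingPPartAt_of_upper_of_nonUnit W p (upperHalfX6_proof hPub W p (by omega) hX h0)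
      (AnticyclotomicRankZero.eisensteinHalfFiveLe_inertPair_of_facts hSh hFH hJL hRT h23 hK13 hGZK hnf
        hMaz W p (ClassX6.not_hasCM W hX) h5 hX h0 ℓ₁ ℓ₂ hne h₁ h₂ hr₁ hr₂))

end PairLevel

/-- **The residual AS A SET OF (E, p) PAIRS after road (I).** Over `PublishedInputsX6`, the pack and the
nine facts, the rung W-ALL/6 on the leaf `ClassX6 ∧ r_an = 0` is EQUIVALENT to: `BSD(E,p)` (i) at every
THIN pair of the leaf with `p ≥ 5` (no erratum prime, no two multiplicative primes with `p ∤ ord Δ_min` —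
0 of the 113 non-unit census cells) and (ii) at every pair of the leaf with `p = 3`. `→`: specialisation;
`←`: an odd prime is `3` or `≥ 5`; at `p ≥ 5` the erratum sub-locus is `BSD(E,p)` by p2's socket, the
inert-pair sub-locus by `X6.bsdp_of_publishedInputsX6_of_inertPairFacts`, the rest by (i).
CONDITIONAL on the inputs. [cite: Kobayashi2003, Thm. 1.2 and Thm. 4.1] [cite: BDKim2013, Cor. 3.15]
[cite: Miller2011LMS, §1 and Def. 1.1] -/
theorem wallCornerX6r0_iff_forall_bsdp_thin_and_three_of_inputs_of_inertPairFacts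
    (hPub : PublishedInputsX6) (hAc : PublishedAcInputsX6Err) :
    Summit.BirchSwinnertonDyer.WAllCornerX6r0 ↔
      ((∀ (W : WeierstrassCurve ℚ) [W.IsElliptic] [W.IsGloballyMinimal] (p : ℕ) [Fact p.Prime],
          5 ≤ p → ClassX6 W p → W.analyticRank = 0 → ¬ HasErratumPrime W p →
          (∀ (ℓ₁ ℓ₂ : ℕ) [Fact ℓ₁.Prime] [Fact ℓ₂.Prime], ℓ₁ ≠ ℓ₂ → Mult W ℓ₁ → Mult W ℓ₂ →
            ¬ p ∣ padicValInt ℓ₁ W.minimalDiscriminantInt →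
              p ∣ padicValInt ℓ₂ W.minimalDiscriminantInt) → BSDp W p) ∧
        ∀ (W : WeierstrassCurve ℚ) [W.IsElliptic] [W.IsGloballyMinimal] (p : ℕ) [Fact p.Prime],
          p = 3 → ClassX6 W p → W.analyticRank = 0 → BSDp W p) := by
  rw [wallCornerX6r0_iff_forall_bsdp_rest_and_three_of_publishedInputsX6_of_publishedAcInputsX6Err hPub
    hAc]
  refine ⟨fun ⟨hR, hT⟩ ↦ ⟨fun W _ _ p _ h5 hX h0 hE _ ↦ hR W p h5 hX h0 hE, hT⟩,
    fun ⟨hR, hT⟩ ↦ ⟨fun W _ _ p _ h5 hX h0 hE ↦ ?_, hT⟩⟩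
  by_cases hpair : ∀ (ℓ₁ ℓ₂ : ℕ) [Fact ℓ₁.Prime] [Fact ℓ₂.Prime], ℓ₁ ≠ ℓ₂ → Mult W ℓ₁ → Mult W ℓ₂ →
      ¬ p ∣ padicValInt ℓ₁ W.minimalDiscriminantInt → p ∣ padicValInt ℓ₂ W.minimalDiscriminantInt
  · exact hR W p h5 hX h0 hE hpair
  · push Not at hpair
    obtain ⟨ℓ₁, ℓ₂, i₁, i₂, hne, h₁, h₂, hr₁, hr₂⟩ := hpair
    exact X6.bsdp_of_publishedInputsX6_of_inertPairFacts hSh hFH hJL hRT h23 hK13 hGZK hnf hMaz W p hPub h5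
      hX h0 ℓ₁ ℓ₂ hne h₁ h₂ hr₁ hr₂

end RoadI

end Summit.BirchSwinnertonDyer.BirchSwinnertonDyer.Theorems
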